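import Summits.HodgeConjecture.HodgeConjecture.Theses.PadicSemiregularLift
import Summits.HodgeConjecture.HodgeConjecture.Theorems.PadicSemiregularLiftFormalLiftingFromClassLiftingGlue
import Summits.HodgeConjecture.HodgeConjecture.Theorems.PadicSemiregularLiftFormalLiftingFromClassLiftingHuAssembly
import Literature.AlgebraicGeometry.KTheory.HuHypercohomologyCriteria
import Literature.AlgebraicGeometry.Crystalline.StaircaseIntegralDegeneration
import Literature.AlgebraicGeometry.Crystalline.HuComplexesHighWeight
import Literature.AlgebraicGeometry.Crystalline.HuComplexesDivision

/-!
# `FormalLiftingFromClassLifting` (P1a of route `PadicSemiregularLift`) modulo three named facts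

The closing file of line `IdeatorFiveSketch` of the crux stmt-HodgeConjecture-13825 (lead c3-0, cycle 3). The
crux — on a Hodge-torsion-free smooth projective `𝒳/W(k)` (`d + 6 < p`, `d ≤ 3 ∨ Ω¹` free), a finite locally free
`E₁` on `X_k` satisfying (⋆) CLASS-LIFTS-IMPLY-OBJECT-LIFTS whose rational class pro-lifts, lifts formally — is
proved here CONDITIONALLY on exactly three named facts of the tree:

* `KTheory.HuKZeroLiftingCriterion` and `KTheory.HuKZeroKernelPresentation` (X. Hu, arXiv:2507.12458, Thm. 1.2 /
  Prop. 11.1 (i), Cor. 10.5 (i), Prop. 9.6; `@[claim … under-review]`): the level-wise `K₀`-lifting criterion and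
  the hypercohomological presentation of `ker(K₀(X_n) → K₀(X_m))` for the `p`-adic thickenings `X_n = 𝒳 ⊗ W/pⁿ`;
* `Crystalline.HodgeDeRhamDegeneratesModTorsion` (Deligne 1968, Thm. 5.5 (ii)): the Hodge–de Rham spectral
  sequence of `𝒳/W` degenerates modulo torsion.

Composition. `HuLine.stepClassLifting_of_hu` (`…HuAssembly`) gives STEP CLASS LIFTING for every finite-level
finite locally free lift of `E₁` from the two Hu facts and the two coherent LATTICE statements
(S) the odd transitions `ℍ^{2r-1}(p^{r,1}_{r,N+3}Ω•) → ℍ^{2r-1}(p^{r,1}_{r,N+2}Ω•)` are onto (`1 ≤ r < p`) and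
(T) compatible families in `ℍ^{2r}(p^{r,1}_{r,N+2}Ω•)` killed by a non-zero integer vanish (`1 ≤ r < d`);
`Glue.liftsFormally_of_stepClassLifting` then climbs the tower with (⋆). This file proves (S) and (T) from
Deligne's degeneration (`Lattice.oddReductionsSurjective_of_hdeg`, `Lattice.evenFamiliesTorsionFree_of_hdeg`):
the torsion-freeness of the hypercohomology of the truncated staircase complexes `σ≤(r-1) p^{(r-•)M}Ω•` in
weights `r < d` (`Crystalline.staircase_torsionFree_hyperExt_stupidTruncLE_weight`, which takes the degeneration and
the crux's torsion-free Hodge cohomology) feeds the criteria of `KTheory/HuHypercohomologyCriteria`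
(`huHReduce_surjective_of_torsionFree`, `staircaseHπ_surjective_of_torsionFree`, `huH_family_eq_zero`); the
weights `r ≥ d` of (S) are unconditional (`Crystalline.huHReduce_odd_surjective_of_lowWeights`, support on the
special fibre); the divisibility input of (T) — the image of `ℍ^{2r}(σ≤ p^{(r-•)(N+2)}Ω•) → ℍ^{2r}(σ≤ p^{(r-•)}Ω•)`
is divisible by `p^{N+1}` — is the chain-level division of the truncated inclusion by `p^{N+1}`
(`Crystalline.deRhamStaircaseHatTruncMul_comp_TruncLE`, `isIso_deRhamStaircaseHatTruncMul`).

What is unconditional elsewhere: rank one (`RankOne.formalLiftingFromClassLifting_of_hasRank_one`), relative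
curves `d ≤ 1` and — modulo the two Hu facts only — relative surfaces `d ≤ 2` (`…HuLowDimension`): the
degeneration enters only the weights `2 ≤ r < d`.
-/

noncomputable section

set_option linter.dupNamespace false

-- hyper-Ext smallness instances for the truncated staircase complexes go through `IsStrictlyGE 0 ⇒ IsGE 0`
-- (as in `Crystalline/HodgeDeRhamDegeneration`, `KTheory/HuHypercohomologyCriteria`); give the search room.
set_option synthInstance.maxHeartbeats 200000

namespace Summit.HodgeConjecture.HodgeConjecture.Theorems.FormalLiftingFromClassLifting

open CategoryTheory AlgebraicGeometry Limits Opposite TopologicalSpace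
open Literature.AlgebraicGeometry Literature.AlgebraicGeometry.Motives
open Literature.AlgebraicGeometry.Motives.WittScheme
open Literature.Algebra.Homology (HyperExt)
open Summit.HodgeConjecture.HodgeConjecture.Theses.PadicSemiregularLift

namespace Lattice

/-- **(S) from Deligne's degeneration modulo torsion.** For `𝒳/W(k)` a smooth proper model of relative dimension
`d` with `p`-torsion-free `Hᵇ(𝒳, 𝒪)`, `Hᵇ(𝒳, Ω¹)` and `d ≤ 3 ∨ Ω¹ ≅ 𝒪^d`, granted
`Crystalline.HodgeDeRhamDegeneratesModTorsion`, the odd level transitions of X. Hu's hypercohomology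
`ℍ^{2r-1}(p^{r,1}_{r,N+3}Ω•) → ℍ^{2r-1}(p^{r,1}_{r,N+2}Ω•)` are surjective for every `r ≥ 1`: in weights `r < d` both
groups are quotients of `ℍ^{2r-1}(σ≤(r-1) p^{(r-•)}Ω•)` because `ℍ^{2r}(σ≤(r-1) p^{(r-•)(N+2)}Ω•)` has no `p`-torsion
(torsion-free Hodge cohomology + degeneration), and in weights `r ≥ d` they are onto by the support of Hu's
complexes on the special fibre. [cite: BlochEsnaultKerz2014pAdic, Rem. 35 and Thm. 36 (1)] -/
theorem oddReductionsSurjective_of_hdeg (hdeg : Crystalline.HodgeDeRhamDegeneratesModTorsion)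
    {p : ℕ} [Fact p.Prime] {k : Type} [Field k] [CharP k p] [PerfectRing k p] {d : ℕ}
    (𝒳 : SchemeOver (WittVector p k)) (h𝒳 : IsSmoothProperModel d 𝒳)
    (hO : ∀ (b : ℕ) (x : structureSheafCohomology 𝒳.left b), (p : ℤ) • x = 0 → x = 0)
    (hΩ : ∀ (b : ℕ) (x : hodgeCohomologyOne 𝒳 b), (p : ℤ) • x = 0 → x = 0)
    (hdisj : d ≤ 3 ∨ Nonempty (cotangentSheaf 𝒳 ≅
      SheafOfModules.free (R := 𝒳.left.ringCatSheaf) (Fin d)))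
    (N r : ℕ) (hr : 1 ≤ r) :
    Function.Surjective (KTheory.huHReduce p k 𝒳 r 1 (Nat.le_succ (N + 2)) (2 * (r : ℤ) - 1)) := by
  have hp0 : (p : ℤ) ≠ 0 := by exact_mod_cast (Fact.out : p.Prime).ne_zero
  refine Crystalline.huHReduce_odd_surjective_of_lowWeights h𝒳 (fun N' r' _ hrd' => ?_) N r hr
  exact KTheory.HuStaircase.huHReduce_surjective_of_torsionFree p k 𝒳 r' (show 1 ≤ N' + 2 by omega)
    (Nat.le_succ (N' + 2)) (2 * (r' : ℤ) - 1) (2 * (r' : ℤ)) (by omega)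
    (fun x hx => Crystalline.staircase_torsionFree_hyperExt_stupidTruncLE_weight 𝒳 hdeg
      (hA := fun n _ => Literature.Algebra.Homology.hasHyperExt_of_isGE _ _ n)
      h𝒳 hO hΩ hdisj r' (N' + 2) hrd' (2 * (r' : ℤ)) (p : ℤ) hp0 x hx)

/-- **(T) from Deligne's degeneration modulo torsion.** For `𝒳/W(k)` a smooth proper model of relative dimension
`d` with `p`-torsion-free `Hᵇ(𝒳, 𝒪)`, `Hᵇ(𝒳, Ω¹)` and `d ≤ 3 ∨ Ω¹ ≅ 𝒪^d`, granted
`Crystalline.HodgeDeRhamDegeneratesModTorsion`, for `1 ≤ r < d` every family `o_N ∈ ℍ^{2r}(p^{r,1}_{r,N+2}Ω•)`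
compatible under Hu's reductions and killed by a non-zero integer vanishes (`lim_N ℍ^{2r}` is torsion-free): the
`p`-adic tower algebra `KTheory.HuStaircase.huH_family_eq_zero` on `H = ℍ^{2r}(σ≤(r-1) p^{(r-•)}Ω•)`, fed by the
torsion-freeness of `H` and of `ℍ^{2r+1}(σ≤(r-1) p^{(r-•)(N+2)}Ω•)` (degeneration) and by the divisibility of the
image of `ℍ^{2r}(σ≤ p^{(r-•)(N+2)}Ω•) → H` by `p^{N+1}` (the truncated inclusion is `p^{N+1}` times a chain map,
`Crystalline/HuComplexesDivision`, the `Ωʲ_{𝒳/W}` having no `p`-torsion).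
[cite: BlochEsnaultKerz2014pAdic, Rem. 35 (2) and Thm. 36 (1)] -/
theorem evenFamiliesTorsionFree_of_hdeg (hdeg : Crystalline.HodgeDeRhamDegeneratesModTorsion)
    {p : ℕ} [Fact p.Prime] {k : Type} [Field k] [CharP k p] [PerfectRing k p] {d : ℕ}
    (𝒳 : SchemeOver (WittVector p k)) (h𝒳 : IsSmoothProperModel d 𝒳)
    (hO : ∀ (b : ℕ) (x : structureSheafCohomology 𝒳.left b), (p : ℤ) • x = 0 → x = 0)
    (hΩ : ∀ (b : ℕ) (x : hodgeCohomologyOne 𝒳 b), (p : ℤ) • x = 0 → x = 0)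
    (hdisj : d ≤ 3 ∨ Nonempty (cotangentSheaf 𝒳 ≅
      SheafOfModules.free (R := 𝒳.left.ringCatSheaf) (Fin d)))
    (r : ℕ) (hrd : r < d) (L : ℤ) (hL : L ≠ 0)
    (o : ∀ N : ℕ, KTheory.huH p k 𝒳 r 1 (N + 2) (2 * (r : ℤ)))
    (ho : ∀ N, KTheory.huHReduce p k 𝒳 r 1 (Nat.le_succ (N + 2)) _ (o (N + 1)) = o N)
    (hLo : ∀ N, L • o N = 0) (N : ℕ) : o N = 0 := by
  have hp0 : (p : ℤ) ≠ 0 := by exact_mod_cast (Fact.out : p.Prime).ne_zero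
  have htf : ∀ (M : ℕ) (n : ℤ) (x : KTheory.HuStaircase.staircaseH p k 𝒳 r M n),
      (p : ℤ) • x = 0 → x = 0 := fun M n x hx =>
    Crystalline.staircase_torsionFree_hyperExt_stupidTruncLE_weight 𝒳 hdeg
      (hA := fun n _ => Literature.Algebra.Homology.hasHyperExt_of_isGE _ _ n) h𝒳 hO hΩ hdisj r M hrd n (p : ℤ) hp0 x hx
  refine KTheory.HuStaircase.huH_family_eq_zero p k 𝒳 r (2 * (r : ℤ)) (htf 1 _)
    (fun N' => KTheory.HuStaircase.staircaseHπ_surjective_of_torsionFree p k 𝒳 r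
      (show 1 ≤ N' + 2 by omega) (2 * (r : ℤ)) (2 * (r : ℤ) + 1) rfl (htf (N' + 2) _))
    (fun N' x => ?_) L hL o ho hLo N
  -- divisibility: the truncated inclusion `σ≤(r-1) p^{(r-•)(N'+2)}Ω• → σ≤(r-1) p^{(r-•)}Ω•` is `p^{N'+1}` times
  -- a chain map (through the auxiliary staircase `p^{ê}Ω•`), hence so is its effect on hypercohomology.
  haveI : ∀ j, Mono ((p : ℤ) • 𝟙 ((Crystalline.algebraicDeRhamComplex 𝒳).X j)) := fun j =>
    IsSmoothProperModel.mono_p_smul_id_algebraicDeRhamComplex_X 𝒳 d h𝒳 j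
  haveI := Crystalline.isIso_deRhamStaircaseHatTruncMul 𝒳 (p : ℤ) r 1 (N' + 2)
  obtain ⟨y, rfl⟩ := (HyperExt.map_bijective_of_isIso
    (X := Crystalline.constantSheafInt (Opens.grothendieckTopology 𝒳.left))
    (Crystalline.deRhamStaircaseHatTruncMul 𝒳 (p : ℤ) r 1 (N' + 2)) (2 * (r : ℤ))).2 x
  refine ⟨HyperExt.map (Crystalline.deRhamStaircaseHatTruncLE 𝒳 (p : ℤ) r (show 1 ≤ N' + 2 by omega))
    (2 * (r : ℤ)) y, ?_⟩
  show HyperExt.map _ _ (HyperExt.map _ _ y) = _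
  rw [← HyperExt.map_comp, Crystalline.deRhamStaircaseHatTruncMul_comp_TruncLE, HyperExt.map_zsmul_hom]
  rfl

end Lattice

/-- **`FormalLiftingFromClassLifting` modulo three named facts.** Granted X. Hu's level-wise `K₀`-lifting
criterion `KTheory.HuKZeroLiftingCriterion` and kernel presentation `KTheory.HuKZeroKernelPresentation`
(arXiv:2507.12458, Thm. 1.2 / Prop. 11.1 (i), Cor. 10.5 (i), Prop. 9.6 — claims of an unrefereed preprint) and
Deligne's degeneration of Hodge–de Rham modulo torsion `Crystalline.HodgeDeRhamDegeneratesModTorsion`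
(Publ. IHÉS 35 (1968), Thm. 5.5 (ii)), the crux P1a of route `PadicSemiregularLift` holds: for `k` perfect of
characteristic `p`, `𝒳/W(k)` a smooth proper model of relative dimension `d`, projective, `d + 6 < p`, with
`p`-torsion-free `Hᵇ(𝒳, 𝒪)`, `Hᵇ(𝒳, Ω¹)` and `d ≤ 3 ∨ Ω¹ ≅ 𝒪^d`, every finite locally free `E₁` on `X_k` with
(⋆) CLASS-LIFTS-IMPLY-OBJECT-LIFTS whose rational class pro-lifts, lifts formally. Proof: step class lifting
for every finite-level lift of `E₁` (`HuLine.stepClassLifting_of_hu`, from the two Hu facts and the lattice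
statements (S)/(T) of `Lattice.oddReductionsSurjective_of_hdeg` / `Lattice.evenFamiliesTorsionFree_of_hdeg`),
then the tower climb with (⋆) (`Glue.liftsFormally_of_stepClassLifting`). CONDITIONAL on exactly the three named
facts taken as hypotheses; unconditional special cases: rank one (`RankOne.formalLiftingFromClassLifting_of_hasRank_one`),
`d ≤ 1`, and `d ≤ 2` modulo the Hu facts only (`…HuLowDimension`).
[cite: Hu2025TruncatedWitt, Thm. 1.2, Prop. 11.1 (i), Cor. 10.5 (i), Prop. 9.6] [cite: Deligne1968, Thm. 5.5 (ii)]
[cite: BlochEsnaultKerz2014pAdic, Thm. 1.3 and §8] -/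
theorem formalLiftingFromClassLifting_of_namedFacts
    (hL : KTheory.HuKZeroLiftingCriterion) (hK : KTheory.HuKZeroKernelPresentation)
    (hdeg : Crystalline.HodgeDeRhamDegeneratesModTorsion) : FormalLiftingFromClassLifting := by
  intro p _ k _ _ _ d 𝒳 h𝒳 _ hp hO hΩ hdisj E₁ hE₁ hstar hξ
  exact Glue.liftsFormally_of_stepClassLifting hE₁ hstar fun n F hF hFE =>
    HuLine.stepClassLifting_of_hu 𝒳 hK hL h𝒳 (by omega)
      (fun N r hr _ => Lattice.oddReductionsSurjective_of_hdeg hdeg 𝒳 h𝒳 hO hΩ hdisj N r hr)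
      (fun r _ hrd => Lattice.evenFamiliesTorsionFree_of_hdeg hdeg 𝒳 h𝒳 hO hΩ hdisj r hrd) hE₁ hξ n F hF hFE

end Summit.HodgeConjecture.HodgeConjecture.Theorems.FormalLiftingFromClassLifting

end
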